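import Summits.HodgeConjecture.HodgeConjecture.Theorems.Ring2HypothesesDescentStandardDDomination
import Summits.HodgeConjecture.HodgeConjecture.Theorems.Ring2AbelianAllStandardBProducts
import Summits.HodgeConjecture.HodgeConjecture.Theorems.Ring2HypothesesDescentAlgebraicCorrespondencesSemisimpleInstances
import HarnessLib

/-!
# Ring 2 hypotheses, descent face — `B(X)`, `D(X)` AND SEMISIMPLICITY UNCONDITIONALLY ON ARAPURA'S STRICT ABELIAN CLASS
# (varieties dominated by the powers of an abelian variety, of a curve or of a surface); André's remark «`A_mot = A` si
# `⋆_L` est algébrique» realised: motivated classes MODELLED ON the strict abelian class are algebraic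

research route conditional on HC_CM; not a corollary; Q11.4-sentence-2 already refuted in dim ≥ 3.
Cell `pub-hodge-ring2` (Hodge ladder STAGE 3), seat `ring2-b05` (binder row b05
`Ring2.Hypotheses.MotivatedImpliesAlgebraicAV`, `Ring2HypothesesDescent.lean` :177), gen 41, companion of
`Ring2HypothesesDescentStandardDDomination.lean` (Arapura 2006 Lemma 4.2, clauses `D` and `B`, along
`HodgeTheory.IsDominatedByPowers`). `HC_CM` (`Theses.RankFourFaces.CMAbelianHodge`) does not occur in this file; nothing
here proves a case of the Hodge conjecture; no binder of `BINDER-OWNERS.md` is discharged; row b05 stays OPEN.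

What is proved (theorems only; no definition, no named fact, no sorry; UNCONDITIONAL unless `B⋆(X, η)` is displayed):
* §1 `forall_standardConjectureBStar_pow_of_standardConjectureBStar` — `B⋆(X, η)` for ONE polarisation class ⟹ `B⋆(Xᵏ, θ)`
  for every power and every `θ` (Kleiman Cor. 2.5 = ab-andre-1's `standardConjectureBStar_tensor`, iterated); hence the
  ONE-POLARISATION form of Arapura's clause `B` (`standardConjectureBStar_of_isDominatedByPowers_of_isPolarizationClass`).
* §2 **ARAPURA 2006 COR. 4.3 — «The Lefschetz standard conjecture holds for any variety motivated by a curve or surface»**: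
  `standardConjectureBStar_of_isDominatedByPowers_of_dim_le_two` (+ hom ≡ num, + all powers).
* §3 **THE STRICT ABELIAN CLASS** (`∃ A : AbelianVariety ℂ, IsDominatedByPowers m V A.dim A.X`, the class of the stage-4
  files `CorCM/Stage4StrictRoad*`: abelian varieties, curves, their products and powers, smooth surjective images, …): for
  every member `V`, **`B⋆(V, θ)` for every `θ`** (Lieberman's `B(A)` = ab-andre-2's `standardConjectureBStar_abelianVariety`, +
  clause `B`), **hom ≡ num on `V`**, **semisimplicity of the algebra of algebraic correspondence operators on each
  `Hᵃ(V(ℂ); ℂ)`**, the same for all powers `Vʲ`, products and smooth surjective images.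
* §4 **ANDRÉ 1996 §2.1, remark after Déf. 1 — «`A_mot(X) = A(X)` si pour tout schéma `Y` dans `𝒱`, polarisé, l'involution
  de Lefschetz est donnée par une correspondance algébrique» — REALISED for `𝒱` = the strict abelian class, where the premise
  HOLDS**: every generator `pr_{X*}(α ∪ ⋆_η β)` of `HodgeTheory.IsMotivatedClass` (same binders) with `X` AND the auxiliary
  `Y` in the strict class is ALGEBRAIC; span form `span_strictAbelianMotivatedGenerators_le_algebraicClasses`
  (**`A_mot^{𝒱_ab}(X)_ℂ ⊆ A(X)_ℂ` for `X ∈ 𝒱_ab`**).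
* §5 Row b05's residue `X` PENCIL BY PENCIL: a compact abelian pencil whose total space lies in the strict class (e.g.
  receives a surjection from `A × S'`) satisfies `B⋆(𝒳, η)` ∀ `η` and Abdulali's transport of algebraicity
  (`InvariantCyclesHoldFor f d`, via the tree's `abdulali1994_holds`) — unconditionally.

READING FOR ROW b05 (docstring only). Gen 40: row b05 ⟺ «`A_mot = A` on the strict abelian class», `A_mot` modelled on
ALL smooth projective varieties; §4: the classes modelled on the strict class itself are algebraic unconditionally; André's
Thm. 0.6.2 (c2) models the Hodge classes of abelian varieties on `{A × B × Y₁ × ⋯ × Y_k}`, `Yᵢ` compact abelian pencil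
totals — the open content of row b05 / of `X = LefschetzBCompactPencils` is that pencil totals are not known to be
dominated by the powers of an abelian variety (§5 covers those that are). HONEST COLUMN: `B⋆`, `D`, `SS` are asserted ONLY
on the strict class / under domination by a variety of dimension `≤ 2` / under a displayed `B⋆(X, η)`; `B(all)`, b10, the
parent node, row b05, `HC_AV`, c2, `X` stay OPEN. Not claimed: André's WEAK motivation, anything categorical, the
`ℚ`-structure.

PRESEARCH: [corpus: `paper:arxiv-math_0501348` Arapura 2006 §4 Thm. 4.1, Lemma 4.2, Cor. 4.3–4.4 and the sentence «We can
recover a result of Lieberman», re-opened this session]; [corpus: `paper:doi-10-1007-bf02698643` André 1996 §2.1 p. 14];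
corpus hybrid + galaxy `all` as in the companion file — certification on the carriers, no novelty in print claimed.

References (bib keys): Arapura2006 (§1 Lemma 1.1–1.3, Cor. 1.2, §4 Thm. 4.1, Lemma 4.2, Cor. 4.3–4.4), Andre1996Motifs
(§0.3, §2.1 Déf. 1 and remark (p. 14), Thm. 0.6.2, §6.3 Remarque 2), Lieberman1968, Kleiman1968AlgebraicCycles (Cor. 2.5,
Thm. 2.9, §3 Cor. 3.9, Thm. 3.11), Kleiman1994StandardConjectures (Thm. 4-1), Jannsen1992 (Thm. 1), Abdulali1994FamiliesAV
((1.1) p. 1122), Milne2020HodgeClassesAV (Prop. 1), VoisinHodgeII2003 (Prop. 9.20–9.21), Fulton1998 (§19.1.2, Cor. 19.2).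
-/

noncomputable section

-- every declaration of this problem lives in `Summit.HodgeConjecture.HodgeConjecture.…` (summit = sub-problem)
set_option linter.dupNamespace false

open CategoryTheory AlgebraicGeometry MonoidalCategory CartesianMonoidalCategory
open Literature.AlgebraicTopology.SingularHomology Literature.Geometry.Kaehler
open Literature.AlgebraicGeometry Literature.AlgebraicGeometry.Motives
  Literature.AlgebraicGeometry.HodgeTheory

namespace Summit.HodgeConjecture.HodgeConjecture.Theorems

variable {m d : ℕ} {V X : SchemeOver ℂ}

/-! ## §1 `B⋆` for one polarisation ⟹ `B⋆` for all powers and all polarisations; clause `B` from one polarisation -/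

/-- **`B⋆(X, η)` for ONE polarisation class ⟹ `B⋆(Xᵏ, θ)` for EVERY cartesian power `Xᵏ` (dimension `k·d`) and EVERY
`θ`** — Kleiman 1968 Cor. 2.5 («`B(X)` and `B(Y)` imply `B(X × Y)`») on the real carriers (ab-andre-1's
`standardConjectureBStar_tensor`, whose conclusion is already for every class of the product), iterated along
`X^{k+1} = Xᵏ ⊗ X`; the power `X⁰ = Spec ℂ` has dimension `0 ≤ 2` (gen 38's `forall_standardConjectureBStar_of_dim_le_two`).
The hypothesis `B⋆(X, η)` is NOT asserted. [cite: Kleiman1968AlgebraicCycles, §2 Cor. 2.5 and Thm. 2.9]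
[cite: Kleiman1994StandardConjectures, §4 Thm. 4-1 (3)] -/
theorem forall_standardConjectureBStar_pow_of_standardConjectureBStar (hX : IsSmoothProjective d X)
    {η : complexBetti X 2} (hη : IsPolarizationClass d X η) (hB : StandardConjectureBStar d X η) :
    ∀ (k : ℕ) (θ : complexBetti (X.pow k) 2), StandardConjectureBStar (k * d) (X.pow k) θ := by
  intro k
  induction k with
  | zero => exact fun θ ↦ forall_standardConjectureBStar_of_dim_le_two (by omega) (hX.pow 0) θ
  | succ k ih =>
    intro θ
    obtain ⟨ηk, hηk⟩ := Ring2.Hypotheses.exists_isPolarizationClass_of_isSmoothProjective (hX.pow k)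
    rw [Nat.add_one_mul]
    exact Ring2.AbelianAll.standardConjectureBStar_tensor (hX.pow k) hX hηk (ih ηk) hη hB θ

/-- **ARAPURA'S CLAUSE `B` FROM ONE POLARISATION**: if `V` (smooth projective, dimension `m`) is dominated by the powers
of `X` (dimension `d`) and `B⋆(X, η)` holds for ONE polarisation class `η` of `X`, then `B⋆(V, θ)` holds for every `θ`
(§1 + the companion file's `standardConjectureBStar_of_isDominatedByPowers`). The hypothesis `B⋆(X, η)` is NOT asserted.
[cite: Arapura2006, §4 Lemma 4.2 and Thm. 4.1] [cite: Kleiman1968AlgebraicCycles, Cor. 2.5 and §3 Cor. 3.9] -/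
theorem standardConjectureBStar_of_isDominatedByPowers_of_isPolarizationClass (hV : IsSmoothProjective m V)
    (hX : IsSmoothProjective d X) (hdom : IsDominatedByPowers m V d X) {η : complexBetti X 2}
    (hη : IsPolarizationClass d X η) (hB : StandardConjectureBStar d X η) (θ : complexBetti V 2) :
    StandardConjectureBStar m V θ :=
  standardConjectureBStar_of_isDominatedByPowers hV hX hdom
    (fun k θ' ↦ forall_standardConjectureBStar_pow_of_standardConjectureBStar hX hη hB (k + 1) θ') θ

/-- **… hom ≡ num on `V` from one polarisation of the dominating `X`** (both sides, every `p + q = m`).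
[cite: Arapura2006, §4 Lemma 4.2] [cite: Kleiman1968AlgebraicCycles, §3 Prop. 3.8 and Cor. 3.9] -/
theorem nondegenerate_algebraicClasses_of_isDominatedByPowers_of_isPolarizationClass (hV : IsSmoothProjective m V)
    (hX : IsSmoothProjective d X) (hdom : IsDominatedByPowers m V d X) {η : complexBetti X 2}
    (hη : IsPolarizationClass d X η) (hB : StandardConjectureBStar d X η) {p q : ℕ} (hpq : p + q = m) :
    (∀ ξ ∈ algebraicClasses V p,
        (∀ b ∈ algebraicClasses V q, cupProduct (show 2 * p + 2 * q = 2 * m by omega) ξ b = 0) → ξ = 0) ∧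
      (∀ b ∈ algebraicClasses V q,
        (∀ ξ ∈ algebraicClasses V p, cupProduct (show 2 * p + 2 * q = 2 * m by omega) ξ b = 0) → b = 0) :=
  nondegenerate_algebraicClasses_of_isDominatedByPowers_of_standardConjectureBStar hV hX hdom
    (fun k θ' ↦ forall_standardConjectureBStar_pow_of_standardConjectureBStar hX hη hB (k + 1) θ') hpq

/-- **… with all polarisations of `X`** (`∀ η, B⋆(X, η)`; a polarisation class exists on `X`, ring2-b05 gen 32's
`Hypotheses.exists_isPolarizationClass_of_isSmoothProjective`). [cite: Arapura2006, §4 Lemma 4.2] -/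
theorem standardConjectureBStar_of_isDominatedByPowers_of_forall (hV : IsSmoothProjective m V)
    (hX : IsSmoothProjective d X) (hdom : IsDominatedByPowers m V d X)
    (hB : ∀ η : complexBetti X 2, StandardConjectureBStar d X η) (θ : complexBetti V 2) :
    StandardConjectureBStar m V θ := by
  obtain ⟨η, hη⟩ := Ring2.Hypotheses.exists_isPolarizationClass_of_isSmoothProjective hX
  exact standardConjectureBStar_of_isDominatedByPowers_of_isPolarizationClass hV hX hdom hη (hB η) θ

/-! ## §2 Arapura's Cor. 4.3: varieties dominated by the powers of a curve or of a surface satisfy `B` -/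

/-- **ARAPURA 2006, COR. 4.3, on the real carriers — «The Lefschetz standard conjecture holds for any variety motivated by
a curve or surface»**: if `V` is dominated by the powers of a smooth projective `X` of dimension `d ≤ 2` through algebraic
correspondences, then `B⋆(V, θ)` for every `θ` — UNCONDITIONALLY: `B⋆(X, η)` for curves and surfaces is Lefschetz `(1,1)`
on `X ⊗ X` (gen 38's `forall_standardConjectureBStar_of_dim_le_two`). (Printed instances — uniruled threefolds,
unirational fourfolds — need the geometric dominations of Arapura §3, not in the tree.)
[cite: Arapura2006, §4 Cor. 4.3 and Lemma 4.2] [cite: Kleiman1968AlgebraicCycles, Cor. 2.5 and 2A10] -/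
theorem standardConjectureBStar_of_isDominatedByPowers_of_dim_le_two (hV : IsSmoothProjective m V)
    (hX : IsSmoothProjective d X) (hd : d ≤ 2) (hdom : IsDominatedByPowers m V d X) (θ : complexBetti V 2) :
    StandardConjectureBStar m V θ :=
  standardConjectureBStar_of_isDominatedByPowers_of_forall hV hX hdom
    (fun η ↦ forall_standardConjectureBStar_of_dim_le_two hd hX η) θ

/-- **… and hom ≡ num** for such `V` (both sides, every `p + q = m`). [cite: Arapura2006, §4 Cor. 4.3 and Lemma 4.2]
[cite: Kleiman1968AlgebraicCycles, §3 Cor. 3.9] -/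
theorem nondegenerate_algebraicClasses_of_isDominatedByPowers_of_dim_le_two (hV : IsSmoothProjective m V)
    (hX : IsSmoothProjective d X) (hd : d ≤ 2) (hdom : IsDominatedByPowers m V d X) {p q : ℕ} (hpq : p + q = m) :
    (∀ ξ ∈ algebraicClasses V p,
        (∀ b ∈ algebraicClasses V q, cupProduct (show 2 * p + 2 * q = 2 * m by omega) ξ b = 0) → ξ = 0) ∧
      (∀ b ∈ algebraicClasses V q,
        (∀ ξ ∈ algebraicClasses V p, cupProduct (show 2 * p + 2 * q = 2 * m by omega) ξ b = 0) → b = 0) := by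
  obtain ⟨η, hη⟩ := Ring2.Hypotheses.exists_isPolarizationClass_of_isSmoothProjective hX
  exact nondegenerate_algebraicClasses_of_isDominatedByPowers_of_isPolarizationClass hV hX hdom hη
    (forall_standardConjectureBStar_of_dim_le_two hd hX η) hpq

/-- **… with all powers**: `B⋆(Vʲ, θ)` for every cartesian power of a variety dominated by the powers of a curve or a
surface — in particular for all powers `Cʲ`, `Sʲ` themselves (`CorCM.Stage4.isDominatedByPowers_self`).
[cite: Arapura2006, §4 Cor. 4.3] [cite: Kleiman1968AlgebraicCycles, Cor. 2.5] -/
theorem standardConjectureBStar_pow_of_isDominatedByPowers_of_dim_le_two (hV : IsSmoothProjective m V)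
    (hX : IsSmoothProjective d X) (hd : d ≤ 2) (hdom : IsDominatedByPowers m V d X) (j : ℕ)
    (θ : complexBetti (V.pow j) 2) : StandardConjectureBStar (j * m) (V.pow j) θ :=
  standardConjectureBStar_of_isDominatedByPowers_of_dim_le_two (hV.pow j) hX hd
    (CorCM.Stage4.isDominatedByPowers_pow hX hV hdom j) θ

/-! ## §3 The strict abelian class: `B⋆`, hom ≡ num and semisimplicity, unconditionally -/

section StrictAbelian

/-- **`B⋆(V, θ)` for every smooth projective `V` dominated by the powers of a complex abelian variety `A`, every `θ`** —
UNCONDITIONALLY: Lieberman's `B(A)` (ab-andre-2's kernel theorem `standardConjectureBStar_abelianVariety`) and Arapura's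
clause `B` (§1). Arapura p. 8: «We can recover a result of Lieberman that the Lefschetz conjecture holds for an Abelian
variety, since its cohomology is generated by `H¹`» — here the converse use: Lieberman feeds the whole strict class.
[cite: Arapura2006, §4 Lemma 4.2 and Cor. 4.4] [cite: Lieberman1968, main theorem] [cite: Kleiman1968AlgebraicCycles, 2A11 and Cor. 2.5] -/
theorem standardConjectureBStar_of_isDominatedByPowers_abelianVariety (A : AbelianVariety ℂ)
    (hV : IsSmoothProjective m V) (hdom : IsDominatedByPowers m V A.dim A.X) (θ : complexBetti V 2) :
    StandardConjectureBStar m V θ :=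
  standardConjectureBStar_of_isDominatedByPowers_of_forall hV (AbelianVariety.isSmoothProjective_holds (A := A)) hdom
    (Ring2.AbelianAll.standardConjectureBStar_abelianVariety A) θ

/-- **`B⋆` on Arapura's strict abelian class** (existential packaging `∃ A, IsDominatedByPowers m V A.dim A.X`, the
hypothesis of the tree's `CorCM.Stage4.hc_of_exists_isDominatedByPowers_abelianVariety`): every `θ`, unconditionally.
[cite: Arapura2006, §4 Lemma 4.2] [cite: Lieberman1968, main theorem] -/
theorem standardConjectureBStar_of_exists_isDominatedByPowers_abelianVariety (hV : IsSmoothProjective m V)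
    (h : ∃ A : AbelianVariety ℂ, IsDominatedByPowers m V A.dim A.X) (θ : complexBetti V 2) :
    StandardConjectureBStar m V θ := by
  obtain ⟨A, hA⟩ := h
  exact standardConjectureBStar_of_isDominatedByPowers_abelianVariety A hV hA θ

/-- **Hom ≡ num (with `ℂ`-coefficients) on the strict abelian class, unconditionally**: for `V` dominated by the powers
of an abelian variety and `p + q = dim V`, the cup pairing on `Nᵖ(V) × N^q(V)` is non-degenerate on both sides.
[cite: Arapura2006, §4 Lemma 4.2 (clause D)] [cite: Lieberman1968, main theorem] [cite: Kleiman1968AlgebraicCycles, §3 Cor. 3.9] -/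
theorem nondegenerate_algebraicClasses_of_exists_isDominatedByPowers_abelianVariety (hV : IsSmoothProjective m V)
    (h : ∃ A : AbelianVariety ℂ, IsDominatedByPowers m V A.dim A.X) {p q : ℕ} (hpq : p + q = m) :
    (∀ ξ ∈ algebraicClasses V p,
        (∀ b ∈ algebraicClasses V q, cupProduct (show 2 * p + 2 * q = 2 * m by omega) ξ b = 0) → ξ = 0) ∧
      (∀ b ∈ algebraicClasses V q,
        (∀ ξ ∈ algebraicClasses V p, cupProduct (show 2 * p + 2 * q = 2 * m by omega) ξ b = 0) → b = 0) := by
  obtain ⟨A, hA⟩ := h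
  obtain ⟨η, hη⟩ := Ring2.Hypotheses.exists_isPolarizationClass_of_isSmoothProjective
    (AbelianVariety.isSmoothProjective_holds (A := A))
  exact nondegenerate_algebraicClasses_of_isDominatedByPowers_of_isPolarizationClass hV
    AbelianVariety.isSmoothProjective_holds hA hη (Ring2.AbelianAll.standardConjectureBStar_abelianVariety A η) hpq

/-- **Semisimplicity on the strict abelian class, unconditionally**: for `V` dominated by the powers of an abelian variety,
the algebra of algebraic correspondence operators on each `Hᵃ(V(ℂ); ℂ)` (generated by the actions of the algebraic
classes of codimension `dim V` on `V ⊗ V`, complex orientation family) is a semisimple ring (Jannsen's theorem on the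
carriers, gens 37–38, fed by `D(V ⊗ V)`). [cite: Jannsen1992, Thm. 1] [cite: Arapura2006, §4 Thm. 4.1 and Lemma 4.2]
[cite: Lieberman1968, main theorem] -/
theorem isSemisimpleRing_adjoin_algebraicOperators_of_exists_isDominatedByPowers_abelianVariety
    (hV : IsSmoothProjective m V) (h : ∃ A : AbelianVariety ℂ, IsDominatedByPowers m V A.dim A.X) (a : ℕ) :
    IsSemisimpleRing (Algebra.adjoin ℂ ((algebraicClasses (V ⊗ V) m).map
      (corrAction complexOrientationFamily hV hV (rfl : a + 2 * m = a + 2 * m)) :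
        Set (Module.End ℂ (complexBetti V a)))) := by
  obtain ⟨A, hA⟩ := h
  obtain ⟨η, hη⟩ := Ring2.Hypotheses.exists_isPolarizationClass_of_isSmoothProjective
    (AbelianVariety.isSmoothProjective_holds (A := A))
  exact isSemisimpleRing_adjoin_algebraicOperators_of_isDominatedByPowers hV AbelianVariety.isSmoothProjective_holds hA
    (fun k θ' ↦ forall_standardConjectureBStar_pow_of_standardConjectureBStar AbelianVariety.isSmoothProjective_holds hη
      (Ring2.AbelianAll.standardConjectureBStar_abelianVariety A η) (k + 1) θ') a

/-- **All powers**: `B⋆(Vʲ, θ)` for every cartesian power of a member of the strict abelian class.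
[cite: Arapura2006, §4 Lemma 4.2] [cite: Lieberman1968, main theorem] -/
theorem standardConjectureBStar_pow_of_exists_isDominatedByPowers_abelianVariety (hV : IsSmoothProjective m V)
    (h : ∃ A : AbelianVariety ℂ, IsDominatedByPowers m V A.dim A.X) (j : ℕ) (θ : complexBetti (V.pow j) 2) :
    StandardConjectureBStar (j * m) (V.pow j) θ := by
  obtain ⟨A, hA⟩ := h
  exact standardConjectureBStar_of_isDominatedByPowers_abelianVariety A (hV.pow j)
    (CorCM.Stage4.isDominatedByPowers_pow AbelianVariety.isSmoothProjective_holds hV hA j) θ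

/-- **Smooth surjective images**: if `Z` lies in the strict abelian class and `f : Z ⟶ Y` is a surjective morphism onto a
smooth projective `Y`, then `B⋆(Y, θ)` for every `θ` (`Y` is again dominated, `CorCM.Stage4.exists_isDominatedByPowers_of_surjective`:
`f_* (hʳ ∪ f^* ·)` is a non-zero multiple of the identity). [cite: Arapura2006, §1 Lemma 1.1 and §4 Lemma 4.2]
[cite: Kleiman1968AlgebraicCycles, Prop. 1.2.4] -/
theorem standardConjectureBStar_of_surjective_of_exists_isDominatedByPowers_abelianVariety {dZ dY : ℕ}
    {Z Y : SchemeOver ℂ} (hZ : IsSmoothProjective dZ Z) (hY : IsSmoothProjective dY Y) (f : Z ⟶ Y)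
    [AlgebraicGeometry.Surjective f.left] (h : ∃ B : AbelianVariety ℂ, IsDominatedByPowers dZ Z B.dim B.X)
    (θ : complexBetti Y 2) : StandardConjectureBStar dY Y θ :=
  standardConjectureBStar_of_exists_isDominatedByPowers_abelianVariety hY
    (CorCM.Stage4.exists_isDominatedByPowers_of_surjective hZ hY f h) θ

/-- **In particular: every smooth projective variety admitting a surjection from a complex abelian variety satisfies
`B⋆`** (for every `θ`). [cite: Arapura2006, §1 Cor. 1.2 and §4 Lemma 4.2] [cite: Lieberman1968, main theorem] -/
theorem standardConjectureBStar_of_surjective_abelianVariety {dY : ℕ} {Y : SchemeOver ℂ} (A : AbelianVariety ℂ)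
    (hY : IsSmoothProjective dY Y) (f : A.X ⟶ Y) [AlgebraicGeometry.Surjective f.left] (θ : complexBetti Y 2) :
    StandardConjectureBStar dY Y θ :=
  standardConjectureBStar_of_surjective_of_exists_isDominatedByPowers_abelianVariety
    (AbelianVariety.isSmoothProjective_holds (A := A)) hY f (CorCM.Stage4.exists_isDominatedByPowers_abelianVariety A) θ

/-- **Products**: `B⋆(V ⊗ W, θ)` for `V`, `W` in the strict abelian class (the product is dominated by the product abelian
variety, `CorCM.Stage4.exists_isDominatedByPowers_tensor`). [cite: Arapura2006, §4 Lemma 4.2] [cite: Kleiman1968AlgebraicCycles, Cor. 2.5] -/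
theorem standardConjectureBStar_tensor_of_exists_isDominatedByPowers_abelianVariety {m' : ℕ} {W : SchemeOver ℂ}
    (hV : IsSmoothProjective m V) (hW : IsSmoothProjective m' W)
    (h : ∃ A : AbelianVariety ℂ, IsDominatedByPowers m V A.dim A.X)
    (h' : ∃ B : AbelianVariety ℂ, IsDominatedByPowers m' W B.dim B.X) (θ : complexBetti (V ⊗ W) 2) :
    StandardConjectureBStar (m + m') (V ⊗ W) θ :=
  standardConjectureBStar_of_exists_isDominatedByPowers_abelianVariety (hV.tensor_holds hW)
    (CorCM.Stage4.exists_isDominatedByPowers_tensor hV hW h h') θ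

/-- **Varieties dominated by the powers of a CURVE satisfy `B⋆`** (every `θ`; the case `d = 1` of §2).
[cite: Arapura2006, §1 Lemma 1.3 and §4 Cor. 4.3] -/
theorem standardConjectureBStar_of_isDominatedByPowers_curve {C : SchemeOver ℂ} (hC : IsSmoothProjective 1 C)
    (hV : IsSmoothProjective m V) (hdom : IsDominatedByPowers m V 1 C) (θ : complexBetti V 2) :
    StandardConjectureBStar m V θ :=
  standardConjectureBStar_of_isDominatedByPowers_of_dim_le_two hV hC (by omega) hdom θ

end StrictAbelian

/-! ## §4 André's remark realised: motivated classes modelled on the strict abelian class are algebraic -/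

section ModelledOnStrictAbelian

variable {n : ℕ} {Y : SchemeOver ℂ}

/-- **A GENERATOR `pr_{X*}(α ∪ ⋆_η β)` OF ANDRÉ'S MOTIVATED CLASSES WITH AUXILIARY VARIETY IN THE STRICT ABELIAN CLASS IS
ALGEBRAIC, unconditionally.** For `X` (dimension `n`) and `Y` (dimension `m`) smooth projective, both dominated by the
powers of abelian varieties `A`, `B`, any orientations `μ` of `(X ⊗ Y)(ℂ)` and `ν` of `X(ℂ)` (the latter with Poincaré
duality), any polarisation class `η` of `X ⊗ Y`, algebraic `α ∈ Nᵃ`, `β ∈ Nᵇ` on `X ⊗ Y` and the degrees of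
`HodgeTheory.IsMotivatedClass`: `pr_{X*}(α ∪ ⋆_η β) ∈ Nᵖ H²ᵖ(X(ℂ); ℂ)`. Proof: `X ⊗ Y` is dominated by the powers of
`A × B` (`CorCM.Stage4.isDominatedByPowers_tensor_prod`), so `B⋆(X ⊗ Y, η)` (§3), i.e. `⋆_η` is an algebraic
correspondence in the degrees `2b → 2b'`; hence `⋆_η β` is algebraic (Voisin II Prop. 9.21, ab-andre's
`map_mem_algebraicClasses_of_isAlgebraicCorrespondence`), so is `α ∪ ⋆_η β` (Prop. 9.20) and its Gysin image under `fst`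
(Fulton 19.1.2). This is André 1996 §2.1, the remark after Déf. 1 («`A_mot(X) = A(X)` si pour tout schéma `Y` dans `𝒱`,
polarisé, l'involution de Lefschetz est donnée par une correspondance algébrique») for `𝒱` = the strict abelian class,
where the premise HOLDS. [cite: Andre1996Motifs, §2.1 Déf. 1 and the remark following it (p. 14)]
[cite: Arapura2006, §4 Lemma 4.2] [cite: Lieberman1968, main theorem] [cite: VoisinHodgeII2003, §9.2.4 Prop. 9.20–9.21] -/
theorem gysinMap_fst_cupProduct_lefschetzInvolution_mem_algebraicClasses_of_isDominatedByPowers_abelianVariety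
    (hX : IsSmoothProjective n X) (hY : IsSmoothProjective m Y) (A B : AbelianVariety ℂ)
    (hXA : IsDominatedByPowers n X A.dim A.X) (hYB : IsDominatedByPowers m Y B.dim B.X)
    (μ : HomologicalOrientation ℂ (ComplexPoints (X ⊗ Y)) (2 * (n + m)))
    (ν : HomologicalOrientation ℂ (ComplexPoints X) (2 * n)) (hν : ν.HasPoincareDuality)
    {η : complexBetti (X ⊗ Y) 2} (hη : IsPolarizationClass (n + m) (X ⊗ Y) η) {a b b' p q : ℕ}
    (h₁ : 2 * (p + m) + 2 * q = 2 * (n + m)) (h₂ : 2 * p + 2 * q = 2 * n) (h₃ : 2 * a + 2 * b' = 2 * (p + m))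
    (h₄ : 2 * b + 2 * b' = 2 * (n + m)) {α : complexBetti (X ⊗ Y) (2 * a)} {β : complexBetti (X ⊗ Y) (2 * b)}
    (hα : α ∈ algebraicClasses (X ⊗ Y) a) (hβ : β ∈ algebraicClasses (X ⊗ Y) b) :
    gysinMap μ ν (AlgPoints.mapContinuous (L := ℂ) (fst X Y)) h₁ h₂
      (cupProduct h₃ α (lefschetzInvolution hη.hasHardLefschetz h₄ β)) ∈ algebraicClasses X p := by
  have hXY : IsSmoothProjective (n + m) (X ⊗ Y) := IsSmoothProjective.tensor_holds hX hY
  have hdom : IsDominatedByPowers (n + m) (X ⊗ Y) (A.prod B).dim (A.prod B).X :=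
    CorCM.Stage4.isDominatedByPowers_tensor_prod A B hX hY hXA hYB
  have hBs := standardConjectureBStar_of_isDominatedByPowers_abelianVariety (A.prod B) hXY hdom η
  have hT : IsAlgebraicCorrespondence (n + m) (n + m) (X ⊗ Y) (X ⊗ Y)
      (lefschetzInvolution hη.hasHardLefschetz h₄) := hBs hη (2 * b) (2 * b') h₄
  have hstar : lefschetzInvolution hη.hasHardLefschetz h₄ β ∈ algebraicClasses (X ⊗ Y) b' :=
    Ring2.AbelianAll.map_mem_algebraicClasses_of_isAlgebraicCorrespondence hXY hXY hT hβ
  have hcup : cupProduct h₃ α (lefschetzInvolution hη.hasHardLefschetz h₄ β) ∈ algebraicClasses (X ⊗ Y) (p + m) :=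
    cupProduct_mem_algebraicClasses_of_degree_eq hXY h₃ hα hstar
  exact gysinMap_mem_algebraicClasses_of_isSmoothProjective hXY hX μ ν hν (fst X Y) h₁ h₂ (by omega) hcup

/-- **`A_mot^{𝒱_ab}(X)_ℂ ⊆ A(X)_ℂ` for `X ∈ 𝒱_ab`** — the span form: for `X` dominated by the powers of an abelian variety,
the `ℂ`-span of the generators of `HodgeTheory.IsMotivatedClass n X p` (same binders, verbatim) whose auxiliary variety
`Y` is ALSO dominated by the powers of an abelian variety is contained in `Nᵖ H²ᵖ(X(ℂ); ℂ)`. André's motivated classes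
`motivatedClasses n X p` are modelled on ALL smooth projective `Y`; on those the statement is row b05's business (gen 40:
row b05 ⟺ `A_mot = A` on the strict abelian class) and stays OPEN. [cite: Andre1996Motifs, §2.1 Déf. 1 and the remark following it (p. 14)]
[cite: Arapura2006, §4 Lemma 4.2] [cite: Lieberman1968, main theorem] -/
theorem span_strictAbelianMotivatedGenerators_le_algebraicClasses (hX : IsSmoothProjective n X)
    (hXA : ∃ A : AbelianVariety ℂ, IsDominatedByPowers n X A.dim A.X) (p : ℕ) :
    Submodule.span ℂ
        {x : complexBetti X (2 * p) |
          ∃ (m : ℕ) (Y : SchemeOver ℂ) (_ : IsSmoothProjective m Y)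
            (_ : ∃ B : AbelianVariety ℂ, IsDominatedByPowers m Y B.dim B.X)
            (μ : HomologicalOrientation ℂ (ComplexPoints (X ⊗ Y)) (2 * (n + m)))
            (ν : HomologicalOrientation ℂ (ComplexPoints X) (2 * n))
            (_ : μ.HasPoincareDuality) (_ : ν.HasPoincareDuality)
            (η : complexBetti (X ⊗ Y) 2) (hη : IsPolarizationClass (n + m) (X ⊗ Y) η)
            (a b b' q : ℕ) (hbb' : b + b' = n + m) (hab : a + b' = p + m) (hq : p + q = n)
            (α : complexBetti (X ⊗ Y) (2 * a)) (β : complexBetti (X ⊗ Y) (2 * b)),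
            α ∈ algebraicClasses (X ⊗ Y) a ∧ β ∈ algebraicClasses (X ⊗ Y) b ∧
              x = gysinMap μ ν (AlgPoints.mapContinuous (L := ℂ) (fst X Y))
                    (show 2 * (p + m) + 2 * q = 2 * (n + m) by omega) (show 2 * p + 2 * q = 2 * n by omega)
                    (cupProduct (show 2 * a + 2 * b' = 2 * (p + m) by omega) α
                      (lefschetzInvolution hη.hasHardLefschetz (show 2 * b + 2 * b' = 2 * (n + m) by omega) β))} ≤
      algebraicClasses X p := by
  obtain ⟨A, hA⟩ := hXA
  refine Submodule.span_le.2 ?_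
  rintro x ⟨m, Y, hY, ⟨B, hB⟩, μ, ν, -, hν, η, hη, a, b, b', q, hbb', hab, hq, α, β, hα, hβ, rfl⟩
  exact gysinMap_fst_cupProduct_lefschetzInvolution_mem_algebraicClasses_of_isDominatedByPowers_abelianVariety hX hY A B
    hA hB μ ν hν hη _ _ _ _ hα hβ

/-- **Every generator of `IsMotivatedClass` modelled on the strict class is a motivated class in André's sense** (the
auxiliary `Y` is smooth projective; bookkeeping: the strict-class generators are among André's generators, so §4 is a
statement about a SUBSPACE of `motivatedClasses n X p`). [cite: Andre1996Motifs, §2.1 Déf. 1 (p. 14)] -/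
theorem span_strictAbelianMotivatedGenerators_le_motivatedClasses (p : ℕ) :
    Submodule.span ℂ
        {x : complexBetti X (2 * p) |
          ∃ (m : ℕ) (Y : SchemeOver ℂ) (_ : IsSmoothProjective m Y)
            (_ : ∃ B : AbelianVariety ℂ, IsDominatedByPowers m Y B.dim B.X)
            (μ : HomologicalOrientation ℂ (ComplexPoints (X ⊗ Y)) (2 * (n + m)))
            (ν : HomologicalOrientation ℂ (ComplexPoints X) (2 * n))
            (_ : μ.HasPoincareDuality) (_ : ν.HasPoincareDuality)
            (η : complexBetti (X ⊗ Y) 2) (hη : IsPolarizationClass (n + m) (X ⊗ Y) η)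
            (a b b' q : ℕ) (hbb' : b + b' = n + m) (hab : a + b' = p + m) (hq : p + q = n)
            (α : complexBetti (X ⊗ Y) (2 * a)) (β : complexBetti (X ⊗ Y) (2 * b)),
            α ∈ algebraicClasses (X ⊗ Y) a ∧ β ∈ algebraicClasses (X ⊗ Y) b ∧
              x = gysinMap μ ν (AlgPoints.mapContinuous (L := ℂ) (fst X Y))
                    (show 2 * (p + m) + 2 * q = 2 * (n + m) by omega) (show 2 * p + 2 * q = 2 * n by omega)
                    (cupProduct (show 2 * a + 2 * b' = 2 * (p + m) by omega) α
                      (lefschetzInvolution hη.hasHardLefschetz (show 2 * b + 2 * b' = 2 * (n + m) by omega) β))} ≤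
      motivatedClasses n X p := by
  refine Submodule.span_le.2 ?_
  rintro x ⟨m, Y, hY, -, μ, ν, hμ, hν, η, hη, a, b, b', q, hbb', hab, hq, α, β, hα, hβ, rfl⟩
  exact Submodule.subset_span ⟨m, Y, hY, μ, ν, hμ, hν, η, hη, a, b, b', q, hbb', hab, hq, α, β, hα, hβ, rfl⟩

end ModelledOnStrictAbelian

/-! ## §5 Row b05's residue `X` on the strict abelian class: compact abelian pencils with a dominated total space -/

section Pencils

variable {𝒳 S : SchemeOver ℂ}

/-- **The residue `X = LefschetzBCompactPencils` holds, pencil by pencil, whenever the TOTAL SPACE lies in the strict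
abelian class**: for a compact pencil of abelian varieties `f : 𝒳 ⟶ S` of relative dimension `d` (André 1996 §6.3 footnote
(2)) whose total space `𝒳` is dominated by the powers of an abelian variety, `B⋆(𝒳, η)` for every `η` — the body of
`Ring2.AbelianAll.CompactAbelianPencilLefschetz` AT THIS PENCIL, unconditionally (§3). The general pencil total is NOT known
to be dominated; `X` stays OPEN. [cite: Andre1996Motifs, §6.3 Remarque 2 (p. 33)] [cite: Arapura2006, §4 Lemma 4.2]
[cite: Lieberman1968, main theorem] -/
theorem standardConjectureBStar_total_of_exists_isDominatedByPowers_abelianVariety {d : ℕ} {f : 𝒳 ⟶ S}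
    (hf : IsCompactAbelianPencil f d) (h : ∃ A : AbelianVariety ℂ, IsDominatedByPowers (d + 1) 𝒳 A.dim A.X)
    (η : complexBetti 𝒳 2) : StandardConjectureBStar (d + 1) 𝒳 η :=
  standardConjectureBStar_of_exists_isDominatedByPowers_abelianVariety hf.isSmoothProjective_total h η

/-- **Hence transport of algebraicity along such a pencil (Abdulali's (1.1) = the global-class form of Grothendieck's
variational Hodge conjecture, `Abdulali1994.InvariantCyclesHoldFor f d`) holds UNCONDITIONALLY** — Abdulali 1994 p. 1122 /
Milne 2020 Prop. 1 is the tree's theorem `Ring2.AbelianAll.abdulali1994_holds`, fed with `B⋆(𝒳)` from §3.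
[cite: Abdulali1994FamiliesAV, (1.1) p. 1122] [cite: Milne2020HodgeClassesAV, Prop. 1 (p. 7)] [cite: Arapura2006, §4 Lemma 4.2] -/
theorem invariantCyclesHoldFor_of_exists_isDominatedByPowers_abelianVariety {d : ℕ} {f : 𝒳 ⟶ S}
    (hf : IsCompactAbelianPencil f d) (h : ∃ A : AbelianVariety ℂ, IsDominatedByPowers (d + 1) 𝒳 A.dim A.X) :
    Abdulali1994.InvariantCyclesHoldFor f d :=
  Ring2.AbelianAll.abdulali1994_holds f hf (standardConjectureBStar_total_of_exists_isDominatedByPowers_abelianVariety hf h)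

/-- **Surjective-image form**: if the total space of the compact abelian pencil receives a surjective morphism from a smooth
projective `Z` in the strict abelian class (e.g. `Z = A × S'` for a pencil becoming constant after a finite base change
`S' → S`), then `B⋆(𝒳, η)` for every `η` and transport of algebraicity holds along `f`.
[cite: Abdulali1994FamiliesAV, (1.1) p. 1122] [cite: Arapura2006, §1 Cor. 1.2 and §4 Lemma 4.2] -/
theorem invariantCyclesHoldFor_of_surjective_of_exists_isDominatedByPowers_abelianVariety {d dZ : ℕ} {f : 𝒳 ⟶ S}
    {Z : SchemeOver ℂ} (hf : IsCompactAbelianPencil f d) (hZ : IsSmoothProjective dZ Z) (g : Z ⟶ 𝒳)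
    [AlgebraicGeometry.Surjective g.left] (h : ∃ B : AbelianVariety ℂ, IsDominatedByPowers dZ Z B.dim B.X) :
    Abdulali1994.InvariantCyclesHoldFor f d :=
  invariantCyclesHoldFor_of_exists_isDominatedByPowers_abelianVariety hf
    (CorCM.Stage4.exists_isDominatedByPowers_of_surjective hZ hf.isSmoothProjective_total g h)

end Pencils

end Summit.HodgeConjecture.HodgeConjecture.Theorems

end
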